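import Mathlib
import Literature.Computability.AlgebraicComplexity.SchonhageStrassen
import HarnessLib

/-!
# Bluestein's chirp trick: values of a polynomial on a geometric progression by one product

Topic `Computability/AlgebraicComplexity`, continuing `SchonhageStrassen.lean` (`ofSeq`).
Harvey 2021, Lemma 2.4 (journal) = Lemma 5 (arXiv): given `α ∈ ℤ_N^*` and `f ∈ ℤ_N[x]` of
degree `n`, the values `f(1), f(α), …, f(α^{m-1})` cost one multiplication of a polynomial of
degree `n` by one of degree `n + m − 1` plus `O(n+m)` multiplications — by the variant of
Bluestein's trick with the identity `ij = C(i,2) + C(−j,2) − C(i−j,2)`: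
`f(α^i) = h_i ∑_j f'_j g_{i−j}` with `h_i = α^{C(i,2)}`, `f'_j = α^{C(j+1,2)} f_j`
(`C(−j,2) = C(j+1,2)`), `g_k = α^{−C(k,2)}`, the inner sum being the coefficient of `x^i` in
`f' · g`, `g = ∑_{k=-n}^{m-1} g_k x^k` a Laurent polynomial.  Here, over any commutative ring `S`
with `αβ = 1`, and with `g` shifted by `x^n` to an honest polynomial:

* `chirpExp n s = C(s − n, 2)` (the exponent of `β` in `g_{s-n}`, `s − n ∈ ℤ`);
* `choose_two_add_choose_two_succ_of_le/of_lt` — the binomial identity in `ℕ`, both signs;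
* **`bluestein_eval`**: `∑_{j≤n} f_j α^{ij} = α^{C(i,2)} · (f' · G)_{i+n}` for `i < m`, where
  `f' = ofSeq (n+1) (α^{C(j+1,2)} f_j)` and `G = ofSeq (n+m) (β^{chirpExp n s})`.

So `m` values of `f` on the progression `α^i` are read off ONE polynomial product (to be done by
`negMul`/Kronecker substitution); this is the algebraic content of the lemma, the cost statement
being a machine matter.

## References

* D. Harvey, *An exponent one-fifth algorithm for deterministic integer factorisation*,
  Math. Comp. 90 (2021), Lemma 2.4 (arXiv:2010.05450, Lemma 5 and eq. (2.2); text checked: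
  `paper:arxiv-2010.05450`, p. 5). [Harvey2021]
* L. I. Bluestein, *A linear filtering approach to the computation of discrete Fourier
  transform*, IEEE Trans. Audio Electroacoust. 18 (1970) 451–455 (the original trick, with
  `ij = (i² + j² − (i−j)²)/2`).
-/

namespace Literature.Computability.AlgebraicComplexity

open _root_.Finset _root_.Polynomial

variable {S : Type*} [CommRing S]

/-- The chirp exponent `C(s − n, 2)` of the (possibly negative) integer `s − n`:
`C(k,2) = k(k−1)/2` for `k ≥ 0` and `C(−l,2) = C(l+1,2)` for `l > 0`. [cite: Harvey2021, Lem. 2.4 (arXiv Lem. 5), proof] -/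
def chirpExp (n s : ℕ) : ℕ := if n ≤ s then (s - n).choose 2 else (n - s + 1).choose 2

/-- `C(i,2) + C(j+1,2) = ij + C(i−j,2)` for `j ≤ i` (the identity
`ij = C(i,2) + C(−j,2) − C(i−j,2)` of Harvey's proof, in `ℕ`). [cite: Harvey2021, Lem. 2.4 (arXiv Lem. 5), proof] -/
theorem choose_two_add_choose_two_succ_of_le {i j : ℕ} (h : j ≤ i) :
    i.choose 2 + (j + 1).choose 2 = i * j + (i - j).choose 2 := by
  have key : ((i.choose 2 + (j + 1).choose 2 : ℕ) : ℚ) = ((i * j + (i - j).choose 2 : ℕ) : ℚ) := by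
    push_cast [Nat.cast_choose_two, Nat.cast_sub h]
    ring
  exact_mod_cast key

/-- `C(i,2) + C(j+1,2) = ij + C(j−i+1,2)` for `i < j` (the same identity when `i − j < 0`).
[cite: Harvey2021, Lem. 2.4 (arXiv Lem. 5), proof] -/
theorem choose_two_add_choose_two_succ_of_lt {i j : ℕ} (h : i < j) :
    i.choose 2 + (j + 1).choose 2 = i * j + (j - i + 1).choose 2 := by
  have key : ((i.choose 2 + (j + 1).choose 2 : ℕ) : ℚ) =
      ((i * j + (j - i + 1).choose 2 : ℕ) : ℚ) := by
    push_cast [Nat.cast_choose_two, Nat.cast_sub h.le]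
    ring
  exact_mod_cast key

/-- **Harvey 2021, Lemma 2.4 (arXiv Lemma 5): Bluestein's chirp trick.**  Let `αβ = 1` in a
commutative ring `S`, `f_0, …, f_n ∈ S`, `m ≥ 1`.  With `f'_j = α^{C(j+1,2)} f_j` (`j ≤ n`) and
`G = ∑_{s < n+m} β^{C(s−n,2)} x^s` (the Laurent polynomial `g` of the source times `x^n`), for
every `i < m`:  `f(α^i) = ∑_{j≤n} f_j α^{ij} = α^{C(i,2)} · (f' G)_{i+n}`.  Hence all of
`f(1), …, f(α^{m−1})` are coefficients `n, …, n+m−1` of a single product of a polynomial of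
degree `n` by one of degree `n+m−1`, up to the `O(n+m)` scalings by `h_i = α^{C(i,2)}`.
[cite: Harvey2021, Lem. 2.4 (arXiv Lem. 5)] -/
theorem bluestein_eval {α β : S} (hαβ : α * β = 1) (n m : ℕ) (f : ℕ → S) {i : ℕ} (hi : i < m) :
    ∑ j ∈ range (n + 1), f j * α ^ (i * j) =
      α ^ i.choose 2 * (ofSeq (n + 1) (fun j => α ^ (j + 1).choose 2 * f j) *
        ofSeq (n + m) (fun s => β ^ chirpExp n s)).coeff (i + n) := by
  rw [coeff_mul, Nat.sum_antidiagonal_eq_sum_range_succ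
    (fun a b => (ofSeq (n + 1) (fun j => α ^ (j + 1).choose 2 * f j)).coeff a *
      (ofSeq (n + m) (fun s => β ^ chirpExp n s)).coeff b) (i + n),
    ← sum_range_add_sum_Ico _ (show n + 1 ≤ i + n + 1 by omega)]
  -- the terms `j > n` vanish
  have h0 : ∑ j ∈ Ico (n + 1) (i + n + 1),
      (ofSeq (n + 1) (fun j => α ^ (j + 1).choose 2 * f j)).coeff j *
        (ofSeq (n + m) (fun s => β ^ chirpExp n s)).coeff (i + n - j) = 0 := by
    refine sum_eq_zero fun j hj => ?_
    have := (mem_Ico.1 hj).1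
    rw [coeff_ofSeq, if_neg (by omega), zero_mul]
  rw [h0, add_zero, mul_sum]
  refine sum_congr rfl fun j hj => ?_
  have hj' : j ≤ n := Nat.lt_succ_iff.1 (mem_range.1 hj)
  rw [coeff_ofSeq, if_pos (by omega), coeff_ofSeq, if_pos (by omega)]
  -- exponent bookkeeping: `α^{C(i,2)} α^{C(j+1,2)} β^{C(i-j,2)} = α^{ij}`
  have hexp : ∀ c : ℕ, i.choose 2 + (j + 1).choose 2 = i * j + c →
      α ^ i.choose 2 * (α ^ (j + 1).choose 2 * f j * β ^ c) = f j * α ^ (i * j) := by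
    intro c hc
    calc α ^ i.choose 2 * (α ^ (j + 1).choose 2 * f j * β ^ c)
        = f j * (α ^ (i.choose 2 + (j + 1).choose 2) * β ^ c) := by rw [pow_add]; ring
      _ = f j * α ^ (i * j) := by rw [hc, pow_add, mul_assoc, ← mul_pow, hαβ, one_pow, mul_one]
  unfold chirpExp
  split_ifs with hle
  · rw [show i + n - j - n = i - j by omega]
    exact (hexp _ (choose_two_add_choose_two_succ_of_le (by omega))).symm
  · rw [show n - (i + n - j) + 1 = j - i + 1 by omega]
    exact (hexp _ (choose_two_add_choose_two_succ_of_lt (by omega))).symm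

end Literature.Computability.AlgebraicComplexity
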